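import Literature.NumberTheory.IwasawaTheory.ZpExtensionLayerSuccRamifiedPrimesLe
import Literature.NumberTheory.IwasawaTheory.CyclotomicTwoTotallyRamifiedOddIndex
import Literature.NumberTheory.IwasawaTheory.NarrowFukudaCertificateLayerTwoModel
import Literature.NumberTheory.NumberFields.QuadraticNonNormUnitDyadicIdeal
import Literature.NumberTheory.NumberFields.QuadraticSqrtTwoNormTwoPrimeCertificate
import HarnessLib

/-!
# The LAYER-ONE unit door with a BASE-FIELD certificate (`p = 2`): `μ₂ = 0`, `λ₂ = 0` for an odd-degree field `K` with `2 ∤ h_K`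
# and at most two primes above `2`, from ONE unit `v = A + B√2` of `K₁ = K(√2)` whose non-norm property from `K₂ = K₁(√(2+√2))`
# is certified by identities and ideal memberships in `𝓞_K` alone

Topic `NumberTheory/IwasawaTheory` (namespace = path).  THEOREMS ONLY (no definition, no named fact, no instance, no `sorry`); unconditional.
Written by the prover seat `bsd-line-att-p3` g41 (cell `bsd-f1-sign2`, WIDTH-5 attach on route `AlignedTransportAtTwo`, crux C2
stmt-BirchSwinnertonDyer-22298; `--supports`, closes nothing).

## What and why

The tree's one-unit door over a base with `p ∤ h_K` (`ClassicalMuVanishesUnitNormIndexTrivialBase.classNumberPExp_eq_of_le_two_of_nonNorm_unit_of_not_dvd`,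
att-p3 g39) concludes `e_m = e_n` for all `m ≥ n` from ONE unit `x` of the layer `K_n` that is not a norm from `K_{n+1}` — but at a layer `n ≥ 1`
its hypotheses `hxE`/`hxN` speak about units and norms INSIDE the abstract layers `κ.layer n ⊂ κ.layer (n+1)`, and the dyadic certificate
(`QuadraticNonNormUnitDyadicIdeal.unitsIncl_unitsMap_not_mem_map_norm_of_sub_one_mem_pow_four`, att-p3 g38: `v − 1 ∈ P⁴ ∖ P⁵` at a prime `P`
of `𝓞 K₁` with `e = 2`, `f = 1`) speaks about a prime ideal of the abstract layer.  No consumer could name `P`, `√2 ∈ K₁`, `√(2+√2) ∈ K₂` or a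
unit of `K₁`.  This file composes the pieces at the layer `n = 1` and pushes EVERY hypothesis down to the base field:

* §1 = the companion file `NumberFields/QuadraticSqrtTwoNormTwoPrimeCertificate.lean` (generic, `[L : K] = 2` Galois, `s ∈ 𝓞_L` with `s² = 2`, `𝔭₁` a prime of `𝓞_K` with `N𝔭₁ = 2` and `2 ∉ 𝔭₁²`, `P ∣ 𝔭₁` a prime of `𝓞_L`):
  `ramificationIdx_eq_two_of_sq_eq_two` (`e(P|𝔭₁) = 2`, one prime above `𝔭₁`, `f = 1` — fundamental identity `g·e·f = 2` and `2𝓞_L = (s)²`),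
  `card_quotient_eq_two_of_sq_eq_two` (`𝓞_L/P = 𝔽₂`), `two_mem_sq_and_two_add_mem_of_sq_eq_two` (`2 ∈ P² ∖ P³`, `2 + s ∈ P ∖ P²`),
  `algebraMap_mem_sq_of_mem_of_not_mem_sq` (`π₁ ∈ 𝔭₁ ∖ 𝔭₁²` ⟹ `π₁ ∈ P² ∖ P³`), and ★ `sub_one_mem_pow_four_of_baseCert`: for `A, B, π₁, d, γ₀, γ₁ ∈ 𝓞_K`
  with `π₁ ∈ 𝔭₁ ∖ 𝔭₁²`, `d, γ₀ ∉ 𝔭₁`, `d(A − 1) = π₁²γ₀`, `dB = π₁²γ₁`: `v = A + Bs` has `v − 1 ∈ P⁴ ∖ P⁵` (`v_P(d) = v_P(γ₀ + γ₁s) = 0`, `v_P(π₁) = 2`).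
* §2 (the layers of a cyclotomic `ℤ₂`-extension `κ` of an odd-degree `K`): `finrank_layer_one_layer_two` (`[K₂ : K₁] = 2`) and
  `exists_sqrt_two_layer_one_sqrt_two_add_layer_two` — `K₁ ∋ s` with `s² = 2` and `K₂ ∋ t` with `t² = 2 + s`, `t ∉ K₁` (from the tree's layer models
  `exists_sq_eq_two_layer_one_of_not_dvd_finrank`, `exists_quartic_root_layer_two_of_not_dvd_finrank`, `finrank_adjoin_quartic_root`; the sign of `s`
  is CHOSEN so that `θ² = 2 + s` for the quartic root `θ`).
* §3 ★★ `classNumberPExp_eq_of_le_of_layerOne_unitCert` / `classicalMuVanishes_two_of_layerOne_unitCert` — `K` of odd degree, `κ` cyclotomic with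
  Fukuda index `0`, `2 ∤ h_K`, at most two primes of `K` above `2`, `𝔭₁` of norm `2` with `2 ∉ 𝔭₁²`, and `A, B, C, D, π₁, d, γ₀, γ₁ ∈ 𝓞_K` with
  `AC + 2BD = 1`, `AD + BC = 0` (so `v = A + Bs` is a unit of `𝓞_{K₁}` with inverse `C + Ds`) and the §1 certificate ⟹ `e_m = e_1` for all `m ≥ 1`,
  `μ₂ = 0`, `λ₂ = 0`; `…_of_not_dvd_discr` forms for `2 ∤ d_K` (index `0` and `2 ∉ 𝔭₁²` discharged, `two_not_mem_sq_of_not_dvd_discr`).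
  The certificate is insensitive to the sign of `s` (both `±s` are square roots of `2`; all conditions are identities in `𝓞_K`).

USE (cell bsd-f1-sign2, crux C2, W-free; nothing about any curve is asserted here): `K = ℚ(β)` the cubic `2`-torsion field of a seed with
`Δ_W ≡ 5 (mod 8)` (`2 = 𝔭₁𝔭₂` with `f(𝔭₁) = 1`, `2 ∤ d_K`) whose fundamental unit is a dyadic norm (`σ₁(ε) ≡ ±1 (mod 8)`), so that Chevalley's
door at the layer `K → K₁` is void (`e₁ ≥ 1`) — the next door is at `K₁ → K₂` and its only input beyond `h(K)` odd is ONE unit `A(θ) + B(θ)√2` of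
`ℚ(β, √2)` with `A ≡ 1`, `B ≡ 0 (mod 𝔭₁²)` (up to a `𝔭₁`-unit `d`) and `(A − 1)/π₁² ∉ 𝔭₁` — a finite search in `ℤ[θ]²`, verified by
`linear_combination` in `ℤ[θ]` and ideal membership at `𝔭₁ = (2, θ − r)` (att-p4's `CubicFieldDiscriminant…ClassNumber` currency).
Every such unit is automatically a local non-norm at the prime of `K₁` above `𝔭₁` (`(5, 2+√2) = −1` in `ℚ₂(√2)`), and `−1`, `1 + √2`, `ε`
are local norms there, so a suitable representative exists whenever `[E_{K₁} : E_{K₁} ∩ N K₂ˣ] > 1`, i.e. exactly when `e_2 = e_1`.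

HONEST SCOPE: classical genus theory + Fukuda (1994) + O'Meara's dyadic local square theorem, all already in the tree as separate files; this file
is the composition and the base-field bookkeeping.  No certificate for any particular field is asserted.  BSD is not advanced by this file.

## References

* T. Fukuda, *Remarks on `ℤ_p`-extensions of number fields*, Proc. Japan Acad. 70 A (1994), Thm. 1 (1), p. 264. [Fukuda1994]
* S. Lang, *Cyclotomic Fields I and II*, GTM 121 (1990), Ch. 13 §4, Lemma 4.1–4.2 and sequel (PDF pp. 203–204). [Lang1990]
* L. C. Washington, *Introduction to Cyclotomic Fields*, 2nd ed., GTM 83 (1997), §13.1 (`ℚ_1 = ℚ(√2)`, `ℚ_2 = ℚ(ζ₁₆)⁺`, `K_n = K·ℚ_n`),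
  Prop. 13.2, §13.3 Prop. 13.22. [Washington1997]
* O. T. O'Meara, *Introduction to Quadratic Forms* (1963), §63A (63:1), §63B (63:10). [Omeara1963]
* J. Neukirch, *Algebraic Number Theory* (1999), Ch. I §8 Prop. (8.2) (fundamental identity, `N𝔭 = p^f`), Ch. III (2.12). [NeukirchANT1999]
-/

noncomputable section

open NumberField IsDedekindDomain Field
open scoped nonZeroDivisors

namespace Literature.NumberTheory.IwasawaTheory

open Literature.NumberTheory.EllipticCurves Literature.NumberTheory.NumberFields
  Literature.NumberTheory.NumberFields.AmbiguousClass
  Literature.NumberTheory.GaloisRepresentations Literature.NumberTheory.GaloisRepresentations.Herbrand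
  Literature.NumberTheory.GaloisRepresentations.MinkowskiUnit
  Literature.NumberTheory.GaloisRepresentations.CyclicNormIndex

/-! ## §2 The layers `K₁ = K(√2) ⊂ K₂ = K₁(√(2+√2))` of a cyclotomic `ℤ₂`-extension of an odd-degree field -/

section Layers

variable {K : Type} [Field K] [NumberField K] (κ : ZpExtension K 2)
  [Algebra (κ.layer 1) (κ.layer (1 + 1))] [IsScalarTower K (κ.layer 1) (κ.layer (1 + 1))]

/-- `[K₂ : K₁] = 2` for a `ℤ₂`-extension (tower law: `[K_n : K] = 2ⁿ`). [cite: Washington1997, §13.1 (`[K_n : K] = pⁿ`)] -/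
theorem finrank_layer_one_layer_two : Module.finrank (κ.layer 1) (κ.layer (1 + 1)) = 2 := by
  haveI : FiniteDimensional K (κ.layer 1) := κ.finiteDimensional_layer_holds 1
  haveI : FiniteDimensional K (κ.layer (1 + 1)) := κ.finiteDimensional_layer_holds (1 + 1)
  haveI : Module.Free (κ.layer 1) (κ.layer (1 + 1)) := Module.Free.of_divisionRing _ _
  have h := Module.finrank_mul_finrank K (κ.layer 1) (κ.layer (1 + 1))
  rw [κ.finrank_layer_holds 1, κ.finrank_layer_holds (1 + 1), pow_succ] at h
  exact Nat.eq_of_mul_eq_mul_left (pow_pos Nat.prime_two.pos 1) h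

omit [IsScalarTower K (κ.layer 1) (κ.layer (1 + 1))] in
/-- **`K₁ ∋ s` with `s² = 2` and `K₂ ∋ t` with `t² = 2 + s`, `t ∉ K₁`** (`2 ∤ [K:ℚ]`, `κ` cyclotomic).  `K₂ = K·ℚ(ζ₁₆)⁺` contains a root
`θ` of `X⁴ − 4X² + 2` (tree `exists_quartic_root_layer_two_of_not_dvd_finrank`); `θ² − 2` is a square root of `2`, hence `= ±s₁` for the
square root `s₁ ∈ K₁` (tree `exists_sq_eq_two_layer_one_of_not_dvd_finrank`); choosing the sign of `s` accordingly gives `θ² = 2 + s`.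
And `θ ∉ K₁`: the minimal polynomial of `θ` over the odd-degree field `K` has degree `4 > [K₁ : K] = 2` (tree
`finrank_adjoin_quartic_root`). [cite: Washington1997, §13.1 (`ℚ_1 = ℚ(√2)`, `ℚ_2 = ℚ(ζ₁₆)⁺`, `K_n = K·ℚ_n`)] -/
theorem exists_sqrt_two_layer_one_sqrt_two_add_layer_two (hK2 : ¬ 2 ∣ Module.finrank ℚ K) (hκ : κ.IsCyclotomic) :
    ∃ s : κ.layer 1, s ^ 2 = 2 ∧ ∃ t : κ.layer (1 + 1),
      t ^ 2 = algebraMap (κ.layer 1) (κ.layer (1 + 1)) (2 + s) ∧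
        t ∉ Set.range (algebraMap (κ.layer 1) (κ.layer (1 + 1))) := by
  haveI : Fact (Nat.Prime 2) := ⟨Nat.prime_two⟩
  haveI : FiniteDimensional K (κ.layer 1) := κ.finiteDimensional_layer_holds 1
  have hodd : Odd (Module.finrank ℚ K) := Nat.not_even_iff_odd.mp fun h => hK2 (even_iff_two_dvd.mp h)
  obtain ⟨s₁, hs₁⟩ := exists_sq_eq_two_layer_one_of_not_dvd_finrank hK2 κ hκ
  obtain ⟨θ, hθ⟩ : ∃ θ : κ.layer (1 + 1), θ ^ 4 - 4 * θ ^ 2 + 2 = 0 :=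
    exists_quartic_root_layer_two_of_not_dvd_finrank hK2 κ hκ
  -- `θ ∉ K₁`
  have hθK : θ ∉ Set.range (algebraMap (κ.layer 1) (κ.layer (1 + 1))) := by
    rintro ⟨a, ha⟩
    have ha4 : a ^ 4 - 4 * a ^ 2 + 2 = 0 := by
      apply (algebraMap (κ.layer 1) (κ.layer (1 + 1))).injective
      rw [map_add, map_sub, map_mul, map_pow, map_pow, map_ofNat, map_ofNat, map_zero, ha, hθ]
    have h4 := finrank_adjoin_quartic_root hodd a ha4
    have htower := Module.finrank_mul_finrank K (IntermediateField.adjoin K ({a} : Set (κ.layer 1))) (κ.layer 1)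
    rw [h4, κ.finrank_layer_holds 1] at htower
    omega
  -- the sign of `s`
  set s₂ : κ.layer (1 + 1) := θ ^ 2 - 2 with hs₂
  have hs₂sq : s₂ ^ 2 = (algebraMap (κ.layer 1) (κ.layer (1 + 1)) s₁) ^ 2 := by
    rw [← map_pow, hs₁, map_ofNat, hs₂]
    linear_combination hθ
  rcases eq_or_eq_neg_of_sq_eq_sq _ _ hs₂sq with h | h
  · refine ⟨s₁, hs₁, θ, ?_, hθK⟩
    rw [map_add, map_ofNat, ← h, hs₂]; ring
  · refine ⟨-s₁, by rw [neg_sq, hs₁], θ, ?_, hθK⟩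
    rw [map_add, map_ofNat, map_neg, ← h, hs₂]; ring

end Layers

/-! ## §3 The door: `μ₂ = 0`, `λ₂ = 0` from `2 ∤ h_K`, at most two primes above `2`, and ONE unit of `K₁` certified in `𝓞_K` -/

section Door

variable {K : Type} [Field K] [NumberField K] (κ : ZpExtension K 2)

/-- ★★ **THE LAYER-ONE UNIT DOOR WITH A BASE-FIELD CERTIFICATE: `e_m = e_1` for all `m ≥ 1`.**  `K` a number field of odd degree with
`2 ∤ h_K` and at most two primes above `2`; `κ` a cyclotomic `ℤ₂`-extension of `K` with Fukuda's index `0` (`TotallyRamifiedFrom κ 0`, e.g.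
`2 ∤ d_K`); `𝔭₁` a prime of `𝓞_K` of norm `2` with `2 ∉ 𝔭₁²` (a degree-one unramified dyadic prime).  DATA IN `𝓞_K`: `A, B, C, D` with
`AC + 2BD = 1`, `AD + BC = 0` (so `v = A + B√2` is a unit of `K₁ = K(√2)` with inverse `C + D√2` — for EITHER square root of `2`), and
`π₁ ∈ 𝔭₁ ∖ 𝔭₁²`, `d ∉ 𝔭₁`, `γ₀ ∉ 𝔭₁`, `γ₁` with `d(A − 1) = π₁²γ₀`, `dB = π₁²γ₁`.  THEN the `2`-class numbers of the layers are constant from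
`K₁` on.  Proof: the prime `P ∣ 𝔭₁` of `K₁` has `e = 2`, `f = 1` (§1), `2 + √2 ∈ P ∖ P²`, `K₂ = K₁(√(2+√2))` (§2), and `v − 1 ∈ P⁴ ∖ P⁵`
(§1), so `v ∉ N(K₂ˣ)` (tree `unitsIncl_unitsMap_not_mem_map_norm_of_sub_one_mem_pow_four`, O'Meara 63:10); at most two primes of `K₁`
ramify in `K₂` (tree `ncard_ramified_layer_succ_le`); the one-unit door over a base with `2 ∤ h_K` at the layer `n = 1` (tree
`classNumberPExp_eq_of_le_two_of_nonNorm_unit_of_not_dvd`) concludes. [cite: Fukuda1994, Thm. 1 (1), p. 264]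
[cite: Lang1990, Ch. 13 §4, Lemma 4.1–4.2 and sequel (PDF pp. 203–204)] [cite: Omeara1963, §63B (63:10)] [cite: Washington1997, §13.3 Prop. 13.22] -/
theorem classNumberPExp_eq_of_le_of_layerOne_unitCert (hκ : κ.IsCyclotomic) (hK2 : ¬ 2 ∣ Module.finrank ℚ K)
    (hram : TotallyRamifiedFrom κ 0) (hK : ¬ 2 ∣ classNumber K)
    (h2 : {v : HeightOneSpectrum (𝓞 K) | ((2 : ℕ) : 𝓞 K) ∈ v.asIdeal}.ncard ≤ 2)
    (𝔭₁ : Ideal (𝓞 K)) (hN : Ideal.absNorm 𝔭₁ = 2) (hunr : (2 : 𝓞 K) ∉ 𝔭₁ ^ 2)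
    {A B C D π₁ d γ₀ γ₁ : 𝓞 K} (hAC : A * C + 2 * B * D = 1) (hAD : A * D + B * C = 0)
    (hπ₁ : π₁ ∈ 𝔭₁) (hπ₁' : π₁ ∉ 𝔭₁ ^ 2) (hd : d ∉ 𝔭₁) (hγ₀ : γ₀ ∉ 𝔭₁)
    (hA : d * (A - 1) = π₁ ^ 2 * γ₀) (hB : d * B = π₁ ^ 2 * γ₁) {m : ℕ} (hm : 1 ≤ m) :
    classNumberPExp κ m = classNumberPExp κ 1 := by
  classical
  haveI : Fact (Nat.Prime 2) := ⟨Nat.prime_two⟩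
  -- the layers `K₁ ⊂ K₂`
  have h12 : κ.layer 1 ≤ κ.layer (1 + 1) := κ.layer_mono (by omega)
  letI : Algebra (κ.layer 1) (κ.layer (1 + 1)) := (IntermediateField.inclusion h12).toRingHom.toAlgebra
  haveI : IsScalarTower K (κ.layer 1) (κ.layer (1 + 1)) :=
    IsScalarTower.of_algebraMap_eq fun x => ((IntermediateField.inclusion h12).commutes x).symm
  haveI : FiniteDimensional K (κ.layer 1) := κ.finiteDimensional_layer_holds 1
  haveI : FiniteDimensional K (κ.layer (1 + 1)) := κ.finiteDimensional_layer_holds (1 + 1)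
  haveI : NumberField (κ.layer 1) := NumberField.of_module_finite K _
  haveI : NumberField (κ.layer (1 + 1)) := NumberField.of_module_finite K _
  haveI : IsGalois K (κ.layer 1) := κ.isGalois_layer_holds 1
  haveI : IsGalois K (κ.layer (1 + 1)) := κ.isGalois_layer_holds (1 + 1)
  haveI : IsGalois (κ.layer 1) (κ.layer (1 + 1)) := IsGalois.tower_top_of_isGalois K _ _
  haveI : FiniteDimensional (κ.layer 1) (κ.layer (1 + 1)) := Module.Finite.of_restrictScalars_finite K _ _
  have hdeg1 : Module.finrank K (κ.layer 1) = 2 := by rw [κ.finrank_layer_holds 1, pow_one]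
  have hdeg2 : Module.finrank (κ.layer 1) (κ.layer (1 + 1)) = 2 := finrank_layer_one_layer_two κ
  -- `s = √2 ∈ K₁`, `t = √(2+s) ∈ K₂ ∖ K₁`
  obtain ⟨s, hs, t, ht, htK⟩ := exists_sqrt_two_layer_one_sqrt_two_add_layer_two κ hK2 hκ
  have hsint : IsIntegral ℤ s := by
    refine ⟨Polynomial.X ^ 2 - Polynomial.C 2, Polynomial.monic_X_pow_sub_C _ two_ne_zero, ?_⟩
    simp [hs]
  set sO : 𝓞 (κ.layer 1) := ⟨s, hsint⟩ with hsO
  have hsO2 : sO ^ 2 = 2 := by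
    apply Subtype.ext
    change ((sO ^ 2 : 𝓞 (κ.layer 1)) : κ.layer 1) = ((2 : 𝓞 (κ.layer 1)) : κ.layer 1)
    push_cast
    exact hs
  set mO : 𝓞 (κ.layer 1) := 2 + sO with hmO
  have hmK : ((mO : 𝓞 (κ.layer 1)) : κ.layer 1) = 2 + s := by rw [hmO, hsO]; rfl
  have hmt : t ^ 2 = algebraMap (κ.layer 1) (κ.layer (1 + 1)) (mO : κ.layer 1) := by rw [ht, hmK]
  -- the prime `𝔭₁` and a prime `P` of `K₁` above it
  obtain ⟨h𝔭, h𝔭0, h2𝔭, -⟩ := isPrime_and_mem_of_absNorm_eq_two 𝔭₁ hN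
  haveI := h𝔭
  haveI : 𝔭₁.IsMaximal := h𝔭.isMaximal h𝔭0
  obtain ⟨P, hPmax, hPover⟩ := Ideal.exists_maximal_ideal_liesOver_of_isIntegral (S := 𝓞 (κ.layer 1)) 𝔭₁
  haveI := hPmax
  haveI := hPover
  have hP0 : P ≠ ⊥ := Ideal.ne_bot_of_liesOver_of_ne_bot h𝔭0 P
  have hres := forall_mem_or_sub_one_mem_of_card_quotient_eq_two P
    (card_quotient_eq_two_of_sq_eq_two hdeg1 hs 𝔭₁ hN hunr P)
  obtain ⟨⟨h2P2, h2P3⟩, hmP, hmP2⟩ := two_mem_sq_and_two_add_mem_of_sq_eq_two hdeg1 hsO2 𝔭₁ h2𝔭 hunr P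
  -- the unit `v = A + B s` of `𝓞 K₁`
  set f := algebraMap (𝓞 K) (𝓞 (κ.layer 1)) with hf
  have hAC' : f A * f C + 2 * (f B * f D) = 1 := by
    have h := congrArg f hAC; simp only [map_add, map_mul, map_ofNat, map_one] at h; linear_combination h
  have hAD' : f A * f D + f B * f C = 0 := by
    have h := congrArg f hAD; simp only [map_add, map_mul, map_zero] at h; exact h
  set v : (𝓞 (κ.layer 1))ˣ := Units.mkOfMulEqOne (f A + f B * sO) (f C + f D * sO)
    (by linear_combination hAC' + sO * hAD' + (f B * f D) * hsO2) with hv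
  obtain ⟨h4, h5⟩ := sub_one_mem_pow_four_of_baseCert hdeg1 hsO2 𝔭₁ h2𝔭 hunr P hπ₁ hπ₁' hd hγ₀ hA hB
  have hv4 : (v : 𝓞 (κ.layer 1)) - 1 ∈ P ^ 4 := by rw [hv, Units.val_mkOfMulEqOne]; exact h4
  have hv5 : (v : 𝓞 (κ.layer 1)) - 1 ∉ P ^ 5 := by rw [hv, Units.val_mkOfMulEqOne]; exact h5
  -- `v ∉ N(K₂ˣ)` and the door at the layer `n = 1`
  have hxE := unitsIncl_unitsMap_mem_unitsE_inf_range (K := κ.layer 1) (L := κ.layer (1 + 1)) v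
  have hxN := unitsIncl_unitsMap_not_mem_map_norm_of_sub_one_mem_pow_four (K := κ.layer 1)
    (L := κ.layer (1 + 1)) hdeg2 hmt htK P hP0 hres h2P2 h2P3 hmP hmP2 v hv4 hv5
  have hs' : {w : HeightOneSpectrum (𝓞 (κ.layer 1)) |
      w.asIdeal.ramificationIdxIn (𝓞 (κ.layer (1 + 1))) ≠ 1}.ncard ≤ 2 :=
    (ncard_ramified_layer_succ_le κ 1 hram).trans h2
  exact classNumberPExp_eq_of_le_two_of_nonNorm_unit_of_not_dvd κ 1 hram hK (Nat.zero_le 1) hs' hxE hxN hm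


/-- ★★ **`μ₂ = 0` (growth form) and `λ₂ = 0` from the layer-one unit certificate** — same hypotheses as
`classNumberPExp_eq_of_le_of_layerOne_unitCert`: the `2`-class numbers are constant from `K₁` on, so Iwasawa's `μ` and `λ` vanish
(`ν = e_1`).  No class group, prime, unit or element of any layer `K_n`, `n ≥ 1`, is an input: everything is an identity or an ideal
membership in `𝓞_K`. [cite: Fukuda1994, Thm. 1 (1), p. 264] [cite: Lang1990, Ch. 13 §4, Lemma 4.1–4.2 and sequel (PDF pp. 203–204)]
[cite: Omeara1963, §63B (63:10)] -/
theorem classicalMuVanishes_two_of_layerOne_unitCert (hκ : κ.IsCyclotomic) (hK2 : ¬ 2 ∣ Module.finrank ℚ K)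
    (hram : TotallyRamifiedFrom κ 0) (hK : ¬ 2 ∣ classNumber K)
    (h2 : {v : HeightOneSpectrum (𝓞 K) | ((2 : ℕ) : 𝓞 K) ∈ v.asIdeal}.ncard ≤ 2)
    (𝔭₁ : Ideal (𝓞 K)) (hN : Ideal.absNorm 𝔭₁ = 2) (hunr : (2 : 𝓞 K) ∉ 𝔭₁ ^ 2)
    {A B C D π₁ d γ₀ γ₁ : 𝓞 K} (hAC : A * C + 2 * B * D = 1) (hAD : A * D + B * C = 0)
    (hπ₁ : π₁ ∈ 𝔭₁) (hπ₁' : π₁ ∉ 𝔭₁ ^ 2) (hd : d ∉ 𝔭₁) (hγ₀ : γ₀ ∉ 𝔭₁)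
    (hA : d * (A - 1) = π₁ ^ 2 * γ₀) (hB : d * B = π₁ ^ 2 * γ₁) :
    ClassicalMuVanishes κ ∧ classicalLambda κ = 0 :=
  ⟨classicalMuVanishes_of_eventually_const κ (c := classNumberPExp κ 1) (n₀ := 1) fun _ hm =>
      classNumberPExp_eq_of_le_of_layerOne_unitCert κ hκ hK2 hram hK h2 𝔭₁ hN hunr hAC hAD hπ₁ hπ₁' hd hγ₀ hA hB hm,
    classicalLambda_eq_zero_of_eventually_const κ (c := classNumberPExp κ 1) (n₀ := 1) fun _ hm =>
      classNumberPExp_eq_of_le_of_layerOne_unitCert κ hκ hK2 hram hK h2 𝔭₁ hN hunr hAC hAD hπ₁ hπ₁' hd hγ₀ hA hB hm⟩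

/-- ★★ **THE DOOR FOR AN ODD-DEGREE FIELD OF ODD DISCRIMINANT** (`2 ∤ d_K`: Fukuda's index is `0` for every cyclotomic `ℤ₂`-extension,
tree `totallyRamifiedFrom_zero_of_not_dvd_discr`, and every dyadic prime is unramified): `2 ∤ h_K`, at most two primes above `2`,
`𝔭₁` a prime of norm `2`, and the base-field certificate `(A, B, C, D, π₁, d, γ₀, γ₁)` ⟹ `e_m = e_1` for all `m ≥ 1`, for EVERY cyclotomic
`ℤ₂`-extension of `K`.  (Cubic `2`-torsion fields `ℚ(β)` with `Δ_W ≡ 5 (mod 8)`: `2 = 𝔭₁𝔭₂`, `𝔭₁` of degree one.)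
[cite: Fukuda1994, Thm. 1 (1), p. 264] [cite: Washington1997, §13.3 Prop. 13.22] [cite: NeukirchANT1999, Ch. III (2.12)] -/
theorem classNumberPExp_eq_of_le_of_layerOne_unitCert_of_not_dvd_discr (hκ : κ.IsCyclotomic)
    (hK2 : ¬ 2 ∣ Module.finrank ℚ K) (hdK : ¬ (2 : ℤ) ∣ NumberField.discr K) (hK : ¬ 2 ∣ classNumber K)
    (h2 : {v : HeightOneSpectrum (𝓞 K) | ((2 : ℕ) : 𝓞 K) ∈ v.asIdeal}.ncard ≤ 2)
    (𝔭₁ : Ideal (𝓞 K)) (hN : Ideal.absNorm 𝔭₁ = 2)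
    {A B C D π₁ d γ₀ γ₁ : 𝓞 K} (hAC : A * C + 2 * B * D = 1) (hAD : A * D + B * C = 0)
    (hπ₁ : π₁ ∈ 𝔭₁) (hπ₁' : π₁ ∉ 𝔭₁ ^ 2) (hd : d ∉ 𝔭₁) (hγ₀ : γ₀ ∉ 𝔭₁)
    (hA : d * (A - 1) = π₁ ^ 2 * γ₀) (hB : d * B = π₁ ^ 2 * γ₁) {m : ℕ} (hm : 1 ≤ m) :
    classNumberPExp κ m = classNumberPExp κ 1 := by
  obtain ⟨h𝔭, -, h2𝔭, -⟩ := isPrime_and_mem_of_absNorm_eq_two 𝔭₁ hN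
  haveI := h𝔭
  exact classNumberPExp_eq_of_le_of_layerOne_unitCert κ hκ hK2 (totallyRamifiedFrom_zero_of_not_dvd_discr hK2 hdK κ hκ)
    hK h2 𝔭₁ hN (two_not_mem_sq_of_not_dvd_discr hdK 𝔭₁ h2𝔭) hAC hAD hπ₁ hπ₁' hd hγ₀ hA hB hm

/-- ★★ **`μ₂ = 0` and `λ₂ = 0` for an odd-degree field of odd discriminant from the layer-one unit certificate**, for EVERY cyclotomic
`ℤ₂`-extension: `2 ∤ [K:ℚ]`, `2 ∤ d_K`, `2 ∤ h_K`, at most two primes above `2`, `N𝔭₁ = 2`, and `(A, B, C, D, π₁, d, γ₀, γ₁)` in `𝓞_K`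
as above.  The W-free consumer form for the cubic `2`-torsion fields `ℚ(β)` of the cell's `Δ_W ≡ 5 (mod 8)` seeds whose fundamental unit is
a dyadic norm (where Chevalley's door at the layer `K → K₁` is void). [cite: Fukuda1994, Thm. 1 (1), p. 264]
[cite: Lang1990, Ch. 13 §4, Lemma 4.1–4.2 and sequel (PDF pp. 203–204)] [cite: Omeara1963, §63B (63:10)] -/
theorem classicalMuVanishes_two_of_layerOne_unitCert_of_not_dvd_discr (hκ : κ.IsCyclotomic)
    (hK2 : ¬ 2 ∣ Module.finrank ℚ K) (hdK : ¬ (2 : ℤ) ∣ NumberField.discr K) (hK : ¬ 2 ∣ classNumber K)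
    (h2 : {v : HeightOneSpectrum (𝓞 K) | ((2 : ℕ) : 𝓞 K) ∈ v.asIdeal}.ncard ≤ 2)
    (𝔭₁ : Ideal (𝓞 K)) (hN : Ideal.absNorm 𝔭₁ = 2)
    {A B C D π₁ d γ₀ γ₁ : 𝓞 K} (hAC : A * C + 2 * B * D = 1) (hAD : A * D + B * C = 0)
    (hπ₁ : π₁ ∈ 𝔭₁) (hπ₁' : π₁ ∉ 𝔭₁ ^ 2) (hd : d ∉ 𝔭₁) (hγ₀ : γ₀ ∉ 𝔭₁)
    (hA : d * (A - 1) = π₁ ^ 2 * γ₀) (hB : d * B = π₁ ^ 2 * γ₁) :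
    ClassicalMuVanishes κ ∧ classicalLambda κ = 0 := by
  obtain ⟨h𝔭, -, h2𝔭, -⟩ := isPrime_and_mem_of_absNorm_eq_two 𝔭₁ hN
  haveI := h𝔭
  exact classicalMuVanishes_two_of_layerOne_unitCert κ hκ hK2 (totallyRamifiedFrom_zero_of_not_dvd_discr hK2 hdK κ hκ)
    hK h2 𝔭₁ hN (two_not_mem_sq_of_not_dvd_discr hdK 𝔭₁ h2𝔭) hAC hAD hπ₁ hπ₁' hd hγ₀ hA hB

end Door

end Literature.NumberTheory.IwasawaTheory

end
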